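import Summits.QuantumAdvantage.QuantumAdvantage.Theses.TwoAdicStationaryPhase
import Literature.Computability.QuantumComplexity.PolyPhaseCircuit
import Literature.Computability.Complexity.PromiseProofs

/-!
# Line `birth` — BC3 skeleton for the crux `TspSignHard` (stmt-QuantumAdvantage-2648)

Route `TwoAdicStationaryPhase` (route-QuantumAdvantage-TwoAdicStationaryPhase; refutation side:
`closes (h₁ : TspSignInPrBPP) (h₂ : TspSignHard) : ¬ QuantumAdvantage`), crux rank 4, HYPOTHESIS-TYPE
(consensus-false given the route's island `TspSignInPrBPP`; never staffed with provers):

  `TspSignHard := ∀ Q ∈ PromiseBQP, Q.PolyTimeReducible POLYSIGN`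

— every promise problem of `PromiseBQP` Karp-reduces to POLYSIGN, the sign problem of ONE-register
polynomial quantum maps: instance `(c [unary], x, y, P₀, [P₁..P_k])`, amplitude
`A = ⟨y| F·D_{P_k} ⋯ F·D_{P₀} |x⟩` on the register `ℤ/4^c` (`F = QFT_{4^c}`, `D_P = e(P(t)/4^c)`),
YES `Re A ≥ 1/3`, NO `Re A ≤ −1/3`.  In the route file POLYSIGN is ONE inlined
`PromiseProblem.ofEncoding …` term; it is copied VERBATIM below as `polySign`
(`tspSignHard_iff : TspSignHard ↔ ∀ Q ∈ PromiseBQP, Q ≤ₚ polySign` is `Iff.rfl`).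

THE LINE (= the route's own two-step analysis of where hardness would have to come from, cf. the
route header, KILL CRITERIA: "an invariant showing one-register words cannot implement a bare
Hadamard on a sub-qubit, OR that r-register polynomial-phase circuits over ℤ/4 are not
encoded-universal"; k = 2, glue = transitivity of Karp reductions among promise problems):

  `TspSignHard ⇐ MultiRegisterHard ∧ RegisterMerging`, through the INTERMEDIATE promise problem
  MULTIPOLYSIGN (`multiPolySign`, typed here over the landed Literature syntax/semantics
  `Literature.Computability.QuantumComplexity.PolyPhaseCircuit`, definition item of route items
  2727/2776): instance `(c [unary], x : List ℕ, y : List ℕ, gates)` with `r := x.length` registers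
  `ℤ/4^c`, each gate either `inl j` = `QFT_{4^c}` on register `j` (`j ≥ r`: dropped) or `inr m` = the
  kick `D_P` of the integer polynomial `P = Σ_{(a, e) ∈ m} a · Π_i X_i^{e_i}` in the `r` register
  variables (monomial list, coefficients in ℕ read mod `4^c`, exponents `e.getD i 0`); amplitude
  `A = ⟨y| U_gates |x⟩ = PolyPhaseCircuit.amplitude (4^c) (circuitOfCode r gates) x y`; YES `Re A ≥ 1/3`,
  NO `Re A ≤ −1/3` (the same sign promise as POLYSIGN; POLYSIGN is its `r = 1`, alternating-word slice,
  `PolyPhaseCircuit.amplitude_chain`).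

* `stub_multiRegisterHard` (LOAD-BEARING; open, consensus-false exactly when the route's multi-register
  island `TspMultiRegister` (stmt-2727, informal) holds and `PromiseBQP ⊄ prBPP`): every `Q ∈ PromiseBQP`
  Karp-reduces to MULTIPOLYSIGN — ENCODED UNIVERSALITY of polynomial-phase circuits on many registers
  of EVEN 2-adic precision `2c ≥ 2` (the `c = 0` registers `ℤ/1` carry nothing).  A priori natural
  (QFT layers + cubic kicks + T-like kicks `e(t/4^c)`; at precision ONE digit, `(ℤ/2)^r` with
  `H = QFT_2` and kicks `(−1)^{P(u)}`, the model IS the sign basis `{H, Z, CZ, CCZ, …}` of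
  `qSimSignProblem`, PromiseBQP-hard in the tree: `AaronsonAmbainis2018_lemma24_sign_hard_holds`);
  the bet is that one extra 2-adic digit per Fourier variable does not destroy encoded universality.
  Why it might fail: the route's exact stationary phase (TspChainLocalisation / DabrowskiFisher1997
  Thm 1.8(a)) is conjectured to localise the r-register path sum onto `≤ 2^{c r'}` critical points
  indexed by first variables (TspMultiRegister), making every amplitude an exact average of
  unimodular poly-time terms ⇒ MULTIPOLYSIGN ∈ prBPP ⇒ this stub puts `PromiseBQP ⊆ prBPP`.
  It is a CONSEQUENCE of the crux (POLYSIGN is the `r = 1` slice: `polySign ≤ₚ multiPolySign` by the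
  syntactic embedding), strictly weaker a priori (more registers, cross-register kicks).
* `stub_registerMerging` (open ARCHITECTURAL step, the one-register content of the crux):
  MULTIPOLYSIGN `≤ₚ` POLYSIGN — `r` registers `ℤ/4^c` with partial QFTs and cross kicks compile into
  ONE alternating word `F·D_{P_k} ⋯ F·D_{P₀}` on one register `ℤ/4^{c'}` with the sign promise kept.
  Why it might fail: the obstruction named in the route header — a QFT on a SUB-register
  (`ℤ/4^{c'} ≅ ` digits, Fourier-transforming only some of them) is not a model gate of the big
  register (it makes the path phase even in the untouched digits and kills the stationary-phase
  constraint), and `x ↦ x ⊕ 2^i`-type digit gates are not ring-polynomial; a structural invariant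
  separating one-register alternating words from two-register circuits refutes it outright
  (informative, unconditional negative knowledge).  Why it might hold: for "wrong" reasons too — if
  MULTIPOLYSIGN ∈ prP (a derandomised island) any fixed YES/NO pair of POLYSIGN instances is a
  reduction; so an unconditional refutation must be structural AND avoid prP = prBPP.
  It is a consequence of the crux given the (true, unformalised) membership MULTIPOLYSIGN ∈ PromiseBQP.
* Glue (sorry-free, standard axioms): `compose` = transitivity
  `Literature.Computability.Complexity.PromiseProblem.PolyTimeReducible.trans_holds` (Goldreich 2006
  §1.2 Def. 3; `PromiseProofs.lean`) applied pointwise in `Q`; `TspSignHard_of : TspSignHard` feeds the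
  two stubs to `compose` through `tspSignHard_iff` and is the ONLY theorem whose head is the crux
  (BY NAME).  Neither stub alone gives the crux: stub 1 needs the merging, stub 2 needs the
  multi-register hardness (which is NOT known — it is the consensus-false half), so the split hides
  no difficulty in a renamed copy of the crux.

Disproof used: none exists for this crux (`ledger crux ls stmt-QuantumAdvantage-2648`: no workfiles —
no `Disproof.lean`, no landed `Theorems/TspSignHard/Negative/*`); `ledger negatives --problem
QuantumAdvantage` (6 entries: RegulatorThird, ShorLocallyDark, CubicStability, SpinorFlattening,
KummerSector, SeparableFrames) has no statement about polynomial-phase / QFT circuits.  The route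
header records why `TspSignHard` (hence `stub_multiRegisterHard`) cannot be refuted outright without
separating `PromiseBQP` from `prBPP`; `stub_registerMerging` is the piece open to an UNCONDITIONAL
structural refutation.

`sorry` occurs ONLY in the two `stub_*` theorems.
-/

-- `Summit.<Summit>.<Problem>`: for the single-conjunct summit the duplicate `QuantumAdvantage.QuantumAdvantage` is mandated.
set_option linter.dupNamespace false

noncomputable section

namespace Summit.QuantumAdvantage.QuantumAdvantage.Cruxes.TspSignHard.Birth

open Summit.QuantumAdvantage.QuantumAdvantage.Theses.TwoAdicStationaryPhase
open Literature.Computability.Complexity Literature.Computability.QuantumComplexity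

/-! ## POLYSIGN by name (verbatim copy of the route's inlined term) -/

/-- **POLYSIGN** — the one-register polynomial-quantum-map sign problem of the route, copied VERBATIM
from the definiens of `TspSignHard` / `TspSignInPrBPP` in `Theses/TwoAdicStationaryPhase.lean`
(instance `I = (c, x, y, P₀, [P₁..P_k])`, `c` unary; YES `Re A ≥ 1/3`, NO `Re A ≤ −1/3`).
[route item stmt-QuantumAdvantage-2648; Vandennest2013 §2, KociaLove2021 §5] -/
def polySign : PromiseProblem :=
  Literature.Computability.Complexity.PromiseProblem.ofEncoding (Computability.unaryEncodingNat.pairBool (Computability.encodingNatBool.pairBool (Computability.encodingNatBool.pairBool (Computability.encodingNatBool.listBool.pairBool Computability.encodingNatBool.listBool.listBool)))) {I : ℕ × ℕ × ℕ × List ℕ × List (List ℕ) | (1 : ℝ) / 3 ≤ ((((2 : ℂ) ^ I.1)⁻¹ ^ (I.2.2.2.2.length + 1) * (∑ v : Fin I.2.2.2.2.length → ZMod (4 ^ I.1), Complex.exp (2 * Real.pi * Complex.I * ((((∑ i : Fin (I.2.2.2.2.length + 1), ((((fun i : Fin (I.2.2.2.2.length + 1) => (∑ j ∈ Finset.range (((I.2.2.2.1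 :: I.2.2.2.2).getD i.val [])).length, Polynomial.C (((((I.2.2.2.1 :: I.2.2.2.2).getD i.val [])).getD j 0 : ℕ) : ℤ) * Polynomial.X ^ j)) i).map (Int.castRingHom (ZMod (4 ^ I.1)))).eval ((Fin.cons (((I.2.1 : ℤ) : ℤ) : ZMod (4 ^ I.1)) (Fin.snoc v (((I.2.2.1 : ℤ) : ℤ) : ZMod (4 ^ I.1))) : Fin (I.2.2.2.2.length + 2) → ZMod (4 ^ I.1)) i.castSucc) + (Fin.cons (((I.2.1 : ℤ) : ℤ) : ZMod (4 ^ I.1)) (Fin.snoc v (((I.2.2.1 : ℤ) : ℤ) : ZMod (4 ^ I.1))) : Fin (I.2.2.2.2.length + 2) → ZMod (4 ^ I.1)) i.castSucc * (Fin.cons (((I.2.1 : ℤ) : ℤ) : ZMod (4 ^ I.1)) (Fin.snoc v (((I.2.2.1 : ℤ) : ℤ) : ZMod (4 ^ I.1))) : Fin (I.2.2.2.2.length + 2) → ZMod (4 ^ I.1)) i.succ))).val : ℂ) / (4 ^ I.1 : ℂ)))))).re} {I : ℕ × ℕ × ℕ × List ℕ × List (List ℕ) | ((((2 : ℂ) ^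 I.1)⁻¹ ^ (I.2.2.2.2.length + 1) * (∑ v : Fin I.2.2.2.2.length → ZMod (4 ^ I.1), Complex.exp (2 * Real.pi * Complex.I * ((((∑ i : Fin (I.2.2.2.2.length + 1), ((((fun i : Fin (I.2.2.2.2.length + 1) => (∑ j ∈ Finset.range (((I.2.2.2.1 :: I.2.2.2.2).getD i.val [])).length, Polynomial.C (((((I.2.2.2.1 :: I.2.2.2.2).getD i.val [])).getD j 0 : ℕ) : ℤ) * Polynomial.X ^ j)) i).map (Int.castRingHom (ZMod (4 ^ I.1)))).eval ((Fin.cons (((I.2.1 : ℤ) : ℤ) : ZMod (4 ^ I.1)) (Fin.snoc v (((I.2.2.1 : ℤ) : ℤ) : ZMod (4 ^ I.1))) : Fin (I.2.2.2.2.length + 2) → ZMod (4 ^ I.1)) i.castSucc) + (Fin.cons (((I.2.1 : ℤ) : ℤ) : ZMod (4 ^ I.1)) (Fin.snoc v (((I.2.2.1 : ℤ) : ℤ) : ZMod (4 ^ I.1))) : Fin (I.2.2.2.2.length + 2) → ZMod (4 ^ I.1)) i.castSucc * (Fin.cons (((I.2.1 : ℤ) : ℤ) : ZMod (4 ^ I.1))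 (Fin.snoc v (((I.2.2.1 : ℤ) : ℤ) : ZMod (4 ^ I.1))) : Fin (I.2.2.2.2.length + 2) → ZMod (4 ^ I.1)) i.succ))).val : ℂ) / (4 ^ I.1 : ℂ)))))).re ≤ -((1 : ℝ) / 3)}

/-- The crux, restated over the name `polySign`: literally (`Iff.rfl`) PromiseBQP-hardness of POLYSIGN
under Karp reductions of promise problems. [folklore] -/
theorem tspSignHard_iff :
    TspSignHard ↔
      ∀ Q ∈ Literature.Computability.Cryptography.PromiseBQP, Q.PolyTimeReducible polySign :=
  Iff.rfl

/-! ## MULTIPOLYSIGN — the intermediate problem (r registers `ℤ/4^c`, partial QFTs, polynomial kicks) -/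

/-- The kick polynomial `P = Σ_{(a, e) ∈ m} a · Π_{i<r} X_i^{e_i}` of a monomial code list
(coefficient `a : ℕ`, exponent vector `e : List ℕ` read with `getD i 0`). [cite: Vandennest2013, §2] -/
def kickOfCode (r : ℕ) (m : List (ℕ × List ℕ)) : MvPolynomial (Fin r) ℤ :=
  (m.map fun ae : ℕ × List ℕ =>
    MvPolynomial.C (ae.1 : ℤ) * ∏ i : Fin r, MvPolynomial.X i ^ (ae.2.getD (i : ℕ) 0)).sum

/-- A gate code: `inl j` = the QFT over `ℤ_{4^c}` on register `j` (codes with `j ≥ r` denote no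
gate), `inr m` = the polynomial phase kick of `kickOfCode r m`. [cite: Vandennest2013, §2] -/
def gateOfCode (r : ℕ) : ℕ ⊕ List (ℕ × List ℕ) → Option (PolyPhaseGate r)
  | Sum.inl j => if h : j < r then some (PolyPhaseGate.qft ⟨j, h⟩) else none
  | Sum.inr m => some (PolyPhaseGate.kick (kickOfCode r m))

/-- The polynomial-phase circuit (Literature syntax `PolyPhaseCircuit r`, head applied first)
denoted by a list of gate codes. [cite: Vandennest2013, §2] -/
def circuitOfCode (r : ℕ) (gs : List (ℕ ⊕ List (ℕ × List ℕ))) : PolyPhaseCircuit r :=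
  gs.filterMap (gateOfCode r)

/-- Instances of MULTIPOLYSIGN: `(c, x, y, gates)` — precision `c` (registers `ℤ/4^c`), input
contents `x` (its length is the number `r` of registers), output contents `y` (read with
`getD i 0`), and the gate codes. [folklore] -/
abbrev MInstance : Type := ℕ × List ℕ × List ℕ × List (ℕ ⊕ List (ℕ × List ℕ))

/-- The transition amplitude `⟨y| U_gates |x⟩` of an instance on `r = x.length` registers `ℤ/4^c`
(Literature semantics `PolyPhaseCircuit.amplitude`, a product of PROVED-unitary gate matrices).
[cite: Vandennest2013, §2] -/
def mAmplitude (I : MInstance) : ℂ :=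
  PolyPhaseCircuit.amplitude (4 ^ I.1) (circuitOfCode I.2.1.length I.2.2.2)
    (fun i : Fin I.2.1.length => ((I.2.1.get i : ℕ) : ZMod (4 ^ I.1)))
    (fun i : Fin I.2.1.length => ((I.2.2.1.getD (i : ℕ) 0 : ℕ) : ZMod (4 ^ I.1)))

/-- Boolean encoding of MULTIPOLYSIGN instances: `c` in UNARY (as for POLYSIGN — binary `c` would
make the `4^c`-arithmetic exponential), lists/pairs/sums by the tree's self-delimiting combinators.
[cite: AroraBarak2009, §0.1] -/
def mEncoding : Computability.Encoding MInstance Bool :=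
  Computability.unaryEncodingNat.pairBool
    (Computability.encodingNatBool.listBool.pairBool
      (Computability.encodingNatBool.listBool.pairBool
        (Computability.encodingNatBool.sumBool
          (Computability.encodingNatBool.pairBool Computability.encodingNatBool.listBool).listBool).listBool))

/-- **MULTIPOLYSIGN**: given `(c, x, y, gates)`, decide whether `Re ⟨y|U|x⟩ ≥ 1/3` (yes) or
`Re ⟨y|U|x⟩ ≤ −1/3` (no), promised one of them; the r-register, cross-kick generalisation of POLYSIGN
(same sign promise). [folklore; model of Vandennest2013 §2 with kicks of arbitrary degree] -/
def multiPolySign : PromiseProblem :=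
  PromiseProblem.ofEncoding mEncoding
    {I : MInstance | (1 : ℝ) / 3 ≤ (mAmplitude I).re}
    {I : MInstance | (mAmplitude I).re ≤ -((1 : ℝ) / 3)}

/-! ## The two registered stubs (signatures fully qualified; registered verbatim) -/

/-- **Stub 1 — multi-register hardness** (LOAD-BEARING; open, consensus-false given the route's
multi-register island).  Every `Q ∈ PromiseBQP` Karp-reduces to MULTIPOLYSIGN: polynomial-phase
circuits (partial `QFT_{4^c}`s + integer-polynomial kicks of any degree across registers) on many
registers of even 2-adic precision are ENCODED-UNIVERSAL for promise-BQP under the sign promise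
`±1/3`.  Why plausibly attempted: at one 2-adic digit the same syntax is the PromiseBQP-hard sign
basis `{H, Z, CZ, CCZ}` (`AaronsonAmbainis2018_lemma24_sign_hard_holds`, with the reflection gadget
`A ↦ 2A² − 1 = −⟨0|Q†(1 − 2|0⟩⟨0|)Q|0⟩` to reach a SIGN promise); cubic kicks + Fourier layers are the
textbook magic ingredients.  Why it might fail: exact 2-adic stationary phase at precision `2c ≥ 2`
(route items TspChainLocalisation, TspMultiRegister) ⇒ MULTIPOLYSIGN ∈ prBPP ⇒ `PromiseBQP ⊆ prBPP`.
Consequence of the crux (`r = 1` slice).  Leans on: `Literature.Computability.Cryptography.PromiseBQP`,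
`PromiseProblem.PolyTimeReducible`, `PolyPhaseCircuit.amplitude`.
Sources: Vandennest2013 §2 (normalizer = quadratic case), KociaLove2021 §5, AaronsonAmbainis2018 §6
Lemma 24, DawsonEtAl2005 (the `ℤ₂` path-sum model). -/
theorem stub_multiRegisterHard :
    ∀ Q ∈ Literature.Computability.Cryptography.PromiseBQP,
      Q.PolyTimeReducible Summit.QuantumAdvantage.QuantumAdvantage.Cruxes.TspSignHard.Birth.multiPolySign := by
  sorry

/-- **Stub 2 — register merging** (open ARCHITECTURAL step).  MULTIPOLYSIGN Karp-reduces to POLYSIGN: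
`r` registers `ℤ/4^c` with partial QFTs and cross-register kicks compile into ONE alternating word
`F·D_{P_k} ⋯ F·D_{P₀}` on a single register `ℤ/4^{c'}`, sign promise preserved.  Why it might fail:
a QFT on a sub-register / digit-level gates are not model gates of the big register (route header:
they make the path phase even in the untouched digits, killing the stationary-phase constraint); an
invariant separating one-register alternating words from two-register circuits refutes it
unconditionally.  Why it might hold for the wrong reason: MULTIPOLYSIGN ∈ prP would make any fixed
YES/NO pair a reduction.  Consequence of the crux given MULTIPOLYSIGN ∈ PromiseBQP.  Leans on:
`PromiseProblem.PolyTimeReducible`, `PolyPhaseCircuit.amplitude`, `PolyPhaseCircuit.amplitude_chain`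
(POLYSIGN's sum is the `chain` word's amplitude).  Sources: Vandennest2013 §2 (partial QFTs),
KociaLove2021 §5 Thm 1, DabrowskiFisher1997 Thm 1.8(a). -/
theorem stub_registerMerging :
    Summit.QuantumAdvantage.QuantumAdvantage.Cruxes.TspSignHard.Birth.multiPolySign.PolyTimeReducible
      Summit.QuantumAdvantage.QuantumAdvantage.Cruxes.TspSignHard.Birth.polySign := by
  sorry

/-! ## Sorry-free glue -/

/-- **Composition of the line** (the real glue, sorry-free; hypotheses = the two stub signatures,
conclusion = the right-hand side of `tspSignHard_iff`): multi-register hardness composed with register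
merging gives PromiseBQP-hardness of POLYSIGN — transitivity of Karp reductions among promise
problems, `PromiseProblem.PolyTimeReducible.trans_holds`. [cite: GoldreichPromise2006, §1.2 Def. 3] -/
theorem compose
    (hHard : ∀ Q ∈ Literature.Computability.Cryptography.PromiseBQP,
      Q.PolyTimeReducible Summit.QuantumAdvantage.QuantumAdvantage.Cruxes.TspSignHard.Birth.multiPolySign)
    (hMerge : Summit.QuantumAdvantage.QuantumAdvantage.Cruxes.TspSignHard.Birth.multiPolySign.PolyTimeReducible
      Summit.QuantumAdvantage.QuantumAdvantage.Cruxes.TspSignHard.Birth.polySign) :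
    ∀ Q ∈ Literature.Computability.Cryptography.PromiseBQP, Q.PolyTimeReducible polySign :=
  fun Q hQ => PromiseProblem.PolyTimeReducible.trans_holds (hHard Q hQ) hMerge

/-- **The skeleton theorem**: the crux `TspSignHard` BY NAME from the two stubs (kernel-checked
composition `compose` + `tspSignHard_iff`; its only `sorry`s are inside `stub_multiRegisterHard` and
`stub_registerMerging`).  `compose` is the implication "stub signatures → crux" up to `Iff.rfl`; this
hypothesis-free form is the one `#h21_check_skeleton` reads (conclusion = the crux decl by name). -/
theorem TspSignHard_of : TspSignHard :=
  tspSignHard_iff.2 (compose stub_multiRegisterHard stub_registerMerging)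

end Summit.QuantumAdvantage.QuantumAdvantage.Cruxes.TspSignHard.Birth

end
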